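import Mathlib
import Summits.Schanuel.Schanuel.Theses.RootDecomp1B

/-!
# RootDecomp1B — the budget triangle (round 4, lens-4 gen 4 «PolarBudgetTriangle»): tree-level arrows
among the items of `route-Schanuel-RootDecomp1B` rev 6

All statements are the route file's own decls (rev 6); nothing is re-declared.  Pure logic plus one order
fact on cardinals (`c < d → c + 1 ≤ d`, `Cardinal.add_one_le_of_lt`); 0 sorry; imports only the route file.

* `noEntangledFirstFailure_iff_free_and_dd` : the EXACT cut of the round-3 residual
  `NoEntangledFirstFailure` (stmt-Schanuel-27215) ⟺ `FreeSideCoupling` (stmt-28104) ∧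
  `NoDoublyDependentFirstFailure` (stmt-28105) — trichotomy on the two side defects.
* `noDefectOneFirstFailure_of_budget_triangle` : `LocalSurplusBudget` (27214) → `FreeSideCoupling` →
  `NoDoublyDependentFirstFailure` → `NoDefectOneFirstFailure` (25470) — the round-2 residual follows.
So when 28104 and 28105 close, 27215 closes by the first theorem and (with 27214) 25470 by the second.
-/

set_option linter.dupNamespace false

namespace Summit.Schanuel.Schanuel.Theorems.RootDecomp1B

open Summit.Schanuel.Schanuel.Theses.RootDecomp1B

/-- `NoEntangledFirstFailure → FreeSideCoupling` (drop the free-side hypothesis). -/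
theorem freeSideCoupling_of_noEntangledFirstFailure :
    NoEntangledFirstFailure → FreeSideCoupling :=
  fun h m r hr hIH hB _ hT => h m r hr hIH hB hT

/-- `NoEntangledFirstFailure → NoDoublyDependentFirstFailure` (drop the two dependence hypotheses). -/
theorem noDoublyDependentFirstFailure_of_noEntangledFirstFailure :
    NoEntangledFirstFailure → NoDoublyDependentFirstFailure :=
  fun h m r hr hIH hB _ _ hT => h m r hr hIH hB hT

/-- The two faces of the budget triangle recover the round-3 residual: either one side is free, or both
side transcendence degrees fall short of `m + ρ` by at least one. -/
theorem noEntangledFirstFailure_of_free_of_dd :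
    FreeSideCoupling → NoDoublyDependentFirstFailure → NoEntangledFirstFailure := by
  intro hFree hDD m r hr hIH hB hT
  refine (Classical.em _).elim (fun h => hFree m r hr hIH hB h hT) (fun h => hDD m r hr hIH hB ?_ ?_ hT)
  · exact Cardinal.add_one_le_of_lt (not_le.mp (not_or.mp h).1)
  · exact Cardinal.add_one_le_of_lt (not_le.mp (not_or.mp h).2)

/-- EXACTNESS of the round-4 cut: stmt-Schanuel-27215 ⟺ stmt-28104 ∧ stmt-28105. -/
theorem noEntangledFirstFailure_iff_free_and_dd :
    NoEntangledFirstFailure ↔ (FreeSideCoupling ∧ NoDoublyDependentFirstFailure) :=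
  ⟨fun h => ⟨freeSideCoupling_of_noEntangledFirstFailure h,
    noDoublyDependentFirstFailure_of_noEntangledFirstFailure h⟩,
    fun h => noEntangledFirstFailure_of_free_of_dd h.1 h.2⟩

/-- Round-4 glue to the round-2 residual: `LocalSurplusBudget → FreeSideCoupling →
NoDoublyDependentFirstFailure → NoDefectOneFirstFailure` (27214 → 28104 → 28105 → 25470). -/
theorem noDefectOneFirstFailure_of_budget_triangle :
    LocalSurplusBudget → FreeSideCoupling → NoDoublyDependentFirstFailure → NoDefectOneFirstFailure := by
  intro hLSB hFree hDD m r hr hIH _ _ hT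
  exact noEntangledFirstFailure_of_free_of_dd hFree hDD m r hr hIH (hLSB m r hr hIH) hT

end Summit.Schanuel.Schanuel.Theorems.RootDecomp1B
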